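import Literature.AnabelianGeometry.EtaleTheta.FrobenioidThetaOfThetaEnvData
import Mathlib

/-!
# [EtTh] §5 ↔ §2 dictionary hypotheses of Lemma 5.9 (iv): the universal closures of
# `CyclotomicCharacterCompatX`, `ThetaSectionCompat`, `KummerOutReached` are REFUTED (PROOF-ONLY)

Mochizuki, *The étale theta function and its Frobenioid-theoretic manifestations*, Publ. RIMS **45**
(2009) [cite: MochizukiEtTh2009, Lem 5.8 proof p.105 (PRIMS p.331); Prop 5.2 (iii) p.98 (PRIMS p.324);
Lem 5.9 (iv) p.106 (PRIMS p.332)].  abc-iut cell, block F (fact-proving wave), seat abc-iut-f-116,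
tranche 116 of `plan/F-TRANCHES.tsv`; PROOF-ONLY companion (0 `def`, 0 `instance`, 0 named `Prop`
fact) of abc-iut-L2-t11's `Discharge/Sec5EnvelopeTopology.lean` (nothing landed is edited).

The rows F-1306 `ThetaFrobenioid.CyclotomicCharacterCompatX` ("`Π^tp_X` [i.e., `G_K` …] acts [on
`μ_N(B_N)`] via multiplication by" the cyclotomic character, Lemma 5.8 proof p.105), F-0521
`ThetaFrobenioid.ThetaSectionCompat` (Prop. 5.2 (iii) p.98 in the coordinates of abc-iut-L2-t2's
`ThetaEnvData`: the bi-Kummer difference cocycle IS the cocycle `η` of the model theta section) and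
F-0520 `ThetaFrobenioid.KummerOutReached` (the `K^×`-part of `D ↦ D_Y`, Lemma 5.8 p.105 / Def. 2.13 (i):
every Kummer outer automorphism of `Π^tp_Y[μ_N]` is reached from `D ⊆ Out(E^Π_N)`) are PARAMETRISED
named hypotheses — predicates on an abstract §5 datum `𝔉 : ThetaFrobenioid C D`, a §2 datum
`T : ThetaEnvData 𝔉.N` and FREE identifications `ι : Π^tp_X̲ ≃ Π^tp_X`, `m : μ_N(B_N) ≃ μ_N` (plus `η`,
resp. the residual `K^×`-datum `DK`).  Header rule R1 (ii) of `F-TRANCHES.tsv`: decide the universal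
closure in the kernel, cite the instance forms.  THIS FILE proves all three universal closures FALSE at
ONE explicit closed toy pair — the first closed `ThetaFrobenioid` term of the tree at which
abc-iut-L2-t4's hypothesis bundle `ThetaFrobenioid.Facts` is INHABITED (`exists_toy`):
* §2 side `T₀ : ThetaEnvData 6`: `Π^tp_X := ℤ × ℤ/2` (discrete), `G_K := Π^tp_X` (`aug := id`),
  `Π^tp_Y := 0 × ℤ/2`, `Π^tp_Ÿ := 1`, `μ_6 := ℤ/6`, `χ :=` inversion`^{pr₁}` (trivial on `Π^tp_Y`; the
  generator of `Gal(Y/X) ≅ ℤ` INVERTS `μ_6`), theta cocycles `{1}`;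
* §5 side `𝔉₀ := ThetaFrobenioid.ofThetaEnvData …` over `C := SingleObj (ℤ/6)` (one object, automorphism
  group `ℤ/6`, so `O^×(B_N) = μ_6(B_N) = Aut_C(B_N) ≅ ℤ/6`) and `D := Discrete PUnit` (`Aut_D(B_N^bs) = 1`):
  trivial divisors and degrees, `ρ = 1`, `s^trv_N = s^⊓-gp_N = s^⊔-gp_N = 1`, `s^⊓_N = s^⊔_N = id`,
  constants `K := 𝔽₂` (`K^× = 1`), `Θ̈ := 1`; `ι := id`, `m : μ_6(B_N) ≃ ℤ/6` tautological;
  `IdentifiesPiY`, `IdentifiesPiYdd` and abc-iut-L2-t4's `Π^tp_Y̲`-version `CyclotomicCharacterCompat` HOLD.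

Kernel verdicts:
* `not_forall_cyclotomicCharacterCompatX` (F-1306) — conjugation by `s^⊓-gp_N(ρ g)` is trivial while
  `χ(aug(ι g))` inverts `μ_6` for the generator `g` of `Gal(Y/X)`; with
  `exists_cyclotomicCharacterCompat_not_compatX`: F-1306 is STRICTLY stronger than F-1307 as typed;
* `not_forall_thetaSectionCompat` (F-0521) — the constant `η := 1 ∈ ℤ/6` violates the dictionary at
  `h = 1` (the dictionary DETERMINES `η`: it is a hypothesis on `η`, cf. `diffCocycle_one`);
* `not_forall_kummerOutReached` (F-0520; pointed form inside `exists_toy`) — with `DK := ∅` the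
  subgroup `D = ⟨galOut ∪ constOut⟩ ⊆ Out(E^Π_N)` is TRIVIAL at the (abelian) toy, while the Kummer shift
  of `Π^tp_Y[μ_6]` by the cocycle `ℤ/2 → μ_6, 1 ↦ 3` inflated from `G_K` is a non-inner outer
  automorphism: the reading `DK := ∅` of Lemma 5.9 (iv) fails (remark of abc-iut-L2-t11's
  `Sec5KummerOutTransport.lean`, MERGE-PLAN row 11, now in the kernel).
Instance forms (R5: the predicates AT the data the cone consumes) are already-landed theorems, cited BY
NAME, not restated: `BiratAutAction.cyclotomicCharacterCompatX_of_galoisDictionary` (F-1306 from the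
Galois dictionary of the constants); `kummerOutReached_preimage` (F-0520 at the canonical `DK₀`),
`BiratAutAction.kummerOutReached_birat` / `BiratAutAction.kummerOutReached_birat_of_continuous` (F-0520
at `DK := kummerOut`, from Kummer theory); no instance of F-0521 is in the tree (merge row W3-L2-01).
HONEST FRAMING: a refuted universal closure says the row is a hypothesis ON DATA (an identification to
be instantiated at the genuine Tate-curve data), not that anything in print is false; the toy is
degenerate by design and asserts nothing about [EtTh]; typed ≠ proved; no side is taken on [IUTchIII]
Cor. 3.12.
-/

namespace Literature.AnabelianGeometry.EtaleTheta

open CategoryTheory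

namespace ThetaFrobenioid

/-- Automorphisms of the object of the one-object category of a COMMUTATIVE group commute (used for
the toy `C := SingleObj (ℤ/6)`, where `Aut_C(B_N) ≅ ℤ/6`). [cite: MochizukiEtTh2009, §5 p.331 (PDF p.105)] -/
theorem singleObj_aut_mul_comm {G : Type} [CommGroup G] (a b : Aut (SingleObj.star G)) :
    a * b = b * a := by
  apply Iso.ext
  change b.hom ≫ a.hom = a.hom ≫ b.hom
  rw [SingleObj.comp_as_mul, SingleObj.comp_as_mul, mul_comm]

section

universe w v v' u u'

variable {C : Type u} [Category.{v} C] {D : Type u'} [Category.{v'} D] (𝔉 : ThetaFrobenioid.{w} C D)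

/-- The bi-Kummer difference cocycle vanishes at `1` (any §5 datum): `s^⊔-gp_N(1) · s^⊓-gp_N(1)⁻¹ = 1`.
[cite: MochizukiEtTh2009, Prop 5.2 (iii) p.98 (PRIMS p.324)] -/
theorem diffCocycle_one (H : 𝔉.Facts) : 𝔉.diffCocycle H 1 = 1 := by
  rw [← 𝔉.unitPart_sCupPi H H.sectionsFactor H.sgpCupSection, map_one]
  exact Subtype.ext (by simp)

end

/-- **The toy §5/§2 pair.**  There are a closed §5 datum `𝔉` over `C := SingleObj (ℤ/6)`,
`D := Discrete PUnit` at which abc-iut-L2-t4's bundle `Facts` holds, a §2 datum `T : ThetaEnvData 6`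
over the same tempered groups (`ι := id`), and the tautological `m : μ_6(B_N) ≃ μ_6`, such that
`IdentifiesPiY`, `IdentifiesPiYdd` and the `Π^tp_Y̲`-cyclotomic dictionary HOLD, while
(1) the `Π^tp_X̲`-cyclotomic dictionary `CyclotomicCharacterCompatX` FAILS, (2) the Prop. 5.2 (iii)
dictionary `ThetaSectionCompat` FAILS for some `η`, (3) `KummerOutReached` FAILS for `DK := ∅`.
[cite: MochizukiEtTh2009, Lem 5.9 (iv) p.106 (PRIMS p.332)] -/
theorem exists_toy :
    ∃ (𝔉 : ThetaFrobenioid.{0} (SingleObj (Multiplicative (ZMod 6))) (Discrete PUnit.{1}))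
      (H : 𝔉.Facts) (T : ThetaEnvData.{0} 𝔉.N) (ι : 𝔉.PiX ≃ₜ* T.PiX)
      (m : 𝔉.muTorsion 𝔉.BN 𝔉.N ≃* T.mu) (hY : 𝔉.IdentifiesPiY T ι.toMulEquiv)
      (hYdd : 𝔉.IdentifiesPiYdd T ι.toMulEquiv) (hχ : 𝔉.CyclotomicCharacterCompat T ι.toMulEquiv m),
      ¬ 𝔉.CyclotomicCharacterCompatX T ι.toMulEquiv m ∧
      (∃ η : T.PiYdd → T.mu, ¬ 𝔉.ThetaSectionCompat H T ι.toMulEquiv m hYdd η) ∧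
      ¬ 𝔉.KummerOutReached H H.sectionsFactor 𝔉.outerActionLZ_of H.sgpCapSection H.sgpCupSection
          H.constantsEqNormalizer ∅ T ι m hY hχ := by
  -- the §2 side: `Π^tp_X := ℤ × ℤ/2` discrete, `μ_6 := ℤ/6` discrete
  letI tX : TopologicalSpace (Multiplicative ℤ × Multiplicative (ZMod 2)) := ⊥
  haveI : DiscreteTopology (Multiplicative ℤ × Multiplicative (ZMod 2)) := ⟨rfl⟩
  haveI : IsTopologicalGroup (Multiplicative ℤ × Multiplicative (ZMod 2)) :=
    { continuous_mul := continuous_of_discreteTopology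
      continuous_inv := continuous_of_discreteTopology }
  letI tμ : TopologicalSpace (Multiplicative (ZMod 6)) := ⊥
  haveI : DiscreteTopology (Multiplicative (ZMod 6)) := ⟨rfl⟩
  let PiY : Subgroup (Multiplicative ℤ × Multiplicative (ZMod 2)) :=
    (MonoidHom.fst (Multiplicative ℤ) (Multiplicative (ZMod 2))).ker
  let χ : Multiplicative ℤ × Multiplicative (ZMod 2) →* MulAut (Multiplicative (ZMod 6)) :=
    (zpowersHom (MulAut (Multiplicative (ZMod 6))) (MulEquiv.inv (Multiplicative (ZMod 6)))).comp
      (MonoidHom.fst _ _)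
  have hχY : ∀ p : PiY, χ (p : Multiplicative ℤ × Multiplicative (ZMod 2)) = 1 := by
    intro p
    have hp : (p : Multiplicative ℤ × Multiplicative (ZMod 2)).1 = 1 := (MonoidHom.mem_ker).mp p.2
    simp [χ, hp]
  have ePiY : PiY ≃ Multiplicative (ZMod 2) :=
    { toFun := fun p => (p : Multiplicative ℤ × Multiplicative (ZMod 2)).2
      invFun := fun b => ⟨(1, b), (MonoidHom.mem_ker).mpr rfl⟩
      left_inv := fun p => Subtype.ext (Prod.ext ((MonoidHom.mem_ker).mp p.2).symm rfl)
      right_inv := fun _ => rfl }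
  let T : ThetaEnvData.{0} 6 :=
    { PiX := Multiplicative ℤ × Multiplicative (ZMod 2)
      G := Multiplicative ℤ × Multiplicative (ZMod 2)
      aug := MonoidHom.id _
      aug_surjective := Function.surjective_id
      PiY := PiY
      PiY_normal := inferInstance
      PiY_open := isOpen_discrete _
      galYX := QuotientGroup.quotientKerEquivOfSurjective _ Prod.fst_surjective
      PiYdd := ⊥
      PiYdd_le := bot_le
      PiYdd_normal := inferInstance
      PiYdd_open := isOpen_discrete _
      index_PiYdd := by
        rw [Subgroup.bot_subgroupOf, Subgroup.index_bot, Nat.card_congr ePiY]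
        simp
      mu := Multiplicative (ZMod 6)
      mu_cyclic := inferInstance
      card_mu := by simp
      chi := χ
      chi_ker_open := isOpen_discrete _
      thetaCocycles := {1}
      thetaCocycles_nonempty := Set.singleton_nonempty _
      isCocycle := by
        intro η hη g h
        rw [Set.mem_singleton_iff] at hη
        subst hη
        simp
      locallyConstant := fun η _ => IsLocallyConstant.of_discrete η
      mul_coboundary_mem := by
        intro η hη c
        rw [Set.mem_singleton_iff] at hη ⊢
        subst hη
        funext g
        have hg : (g : Multiplicative ℤ × Multiplicative (ZMod 2)) = 1 := (Subgroup.mem_bot).mp g.2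
        simp [CycEnvelope.coboundary, hg] }
  -- the §5 side: the tempered-Frobenioid stub over `SingleObj (ℤ/6)` → `Discrete PUnit`
  let F : FrobenioidTheta.TemperedFrobenioidStub.{0} (SingleObj (Multiplicative (ZMod 6)))
      (Discrete PUnit.{1}) :=
    { pre :=
        { base := Functor.star _, Mon := fun _ => PUnit, pull := fun _ => 1, pull_id := fun _ _ => rfl,
          pull_comp := fun _ _ _ => rfl, div := fun _ => PUnit.unit, degFr := fun _ => 1,
          div_id := fun _ => rfl, div_comp := fun _ _ => rfl, degFr_id := fun _ => rfl,
          degFr_comp := fun _ _ => rfl }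
      units_comm := fun S => ⟨⟨fun a b => Subtype.ext (singleObj_aut_mul_comm a.1 b.1)⟩⟩
      biratUnits := fun _ => Multiplicative (ZMod 6)
      unitsToBirat := fun S => { toFun := fun u => u.1.hom, map_one' := rfl, map_mul' := fun _ _ => rfl }
      unitsToBirat_injective := fun S a b h => Subtype.ext (Iso.ext h)
      unitsPull := fun _ => 1
      IsBaseFrobeniusType := ⊤ }
  let Q : FrobenioidTheta.ThetaSubquotientStub.{0} (Discrete PUnit.{1}) :=
    { lDelta := fun _ => PUnit, lDeltaMap := fun _ => 1 }
  have hAutD : ∀ (X : Discrete PUnit.{1}) (g : Aut X), g = 1 := fun X g =>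
    Iso.ext (Subsingleton.elim _ _)
  have hconst : Function.Injective (1 : (ZMod 2)ˣ →* Multiplicative (ZMod 6)) := by
    intro a b _
    have : ∀ x y : (ZMod 2)ˣ, x = y := by decide
    exact this a b
  let 𝔉 : ThetaFrobenioid.{0} (SingleObj (Multiplicative (ZMod 6))) (Discrete PUnit.{1}) :=
    ThetaFrobenioid.ofThetaEnvData F Q 1 odd_one 6 T (SingleObj.star _) (SingleObj.star _)
      (SingleObj.star _) (𝟙 _) (𝟙 _) rfl ⟨rfl, by change IsIso (𝟙 _); infer_instance⟩
      ⟨rfl, by change IsIso (𝟙 _); infer_instance⟩ 1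
      (fun g => ⟨1, by rw [map_one]; exact (hAutD _ _).symm⟩)
      (isOpen_discrete _) 1 1 1 (ZMod 2) 1 hconst 1
  -- every automorphism of `B_N` is a unit and is `6`-torsion; `μ_6(B_N) = Aut_C(B_N) ≅ ℤ/6`
  have h6 : ∀ x : Multiplicative (ZMod 6), x ^ 6 = 1 := by decide
  let φA : Aut (SingleObj.star (Multiplicative (ZMod 6))) →* Multiplicative (ZMod 6) :=
    { toFun := fun a => a.hom, map_one' := rfl, map_mul' := fun _ _ => rfl }
  have hφA : Function.Injective φA := fun a b h => Iso.ext h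
  have hpow : ∀ u : Aut (SingleObj.star (Multiplicative (ZMod 6))), u ^ 6 = 1 := fun u =>
    hφA (by rw [map_pow, map_one]; exact h6 _)
  have hunits : ∀ u : Aut 𝔉.BN, u ∈ 𝔉.units 𝔉.BN := fun u => ⟨Subsingleton.elim _ _, rfl⟩
  have hmu : ∀ u : Aut 𝔉.BN, u ∈ 𝔉.muTorsion 𝔉.BN 𝔉.N := fun u => ⟨hunits u, hpow u⟩
  have H : 𝔉.Facts :=
    { sgpCapSpec := fun g => rfl
      sgpCupSpec := fun h => rfl
      strvSection := fun g => (hAutD _ _).trans (hAutD _ _).symm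
      biKummerDifferenceMem := fun h => by
        change (1 : Aut 𝔉.BN) * (1 : Aut 𝔉.BN)⁻¹ ∈ 𝔉.muTorsion 𝔉.BN 𝔉.N
        rw [inv_one, mul_one]
        exact one_mem _
      autAmpleBN := fun g => ⟨1, (hAutD _ _).trans (hAutD _ _).symm⟩
      constantsActByCyclotome := by
        intro u
        constructor
        · intro _
          refine ⟨hunits u, fun y _ => ?_⟩
          change (1 : Aut 𝔉.BN) * u * (1 : Aut 𝔉.BN)⁻¹ * u⁻¹ ∈ 𝔉.muTorsion 𝔉.BN 𝔉.N
          rw [inv_one, mul_one, one_mul, mul_inv_cancel]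
          exact one_mem _
        · intro _
          refine Subgroup.mem_map.mpr ⟨⟨u, hunits u⟩, ?_, rfl⟩
          rw [Subgroup.mem_comap, ThetaFrobenioid.mem_KxRootN]
          exact ⟨1, by rw [map_one]; exact (h6 _).symm⟩
      epi_sCap := by change Epi (𝟙 _); infer_instance
      epi_sCup := by change Epi (𝟙 _); infer_instance }
  let m : 𝔉.muTorsion 𝔉.BN 𝔉.N ≃* Multiplicative (ZMod 6) :=
    MulEquiv.ofBijective (φA.comp (𝔉.muTorsion 𝔉.BN 𝔉.N).subtype)
      ⟨fun a b h => Subtype.ext (hφA h), fun x =>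
        ⟨⟨(Groupoid.isoEquivHom _ _).symm x, hmu _⟩, rfl⟩⟩
  have hY : 𝔉.IdentifiesPiY T (ContinuousMulEquiv.refl _).toMulEquiv := by
    intro y
    change y ∈ T.zquot.ker ↔ y ∈ T.PiY
    rw [T.ker_zquot]
  have hYdd : 𝔉.IdentifiesPiYdd T (ContinuousMulEquiv.refl _).toMulEquiv := fun _ => Iff.rfl
  -- the `Π^tp_Y̲`-cyclotomic dictionary HOLDS (χ is trivial on `Π^tp_Y`, conjugation is trivial)
  have hχ : 𝔉.CyclotomicCharacterCompat T (ContinuousMulEquiv.refl _).toMulEquiv m := by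
    intro y hy u u' hu'
    have hyu : u' = u := by
      apply Subtype.ext
      rw [hu']
      change (1 : Aut 𝔉.BN) * u * (1 : Aut 𝔉.BN)⁻¹ = u
      rw [inv_one, mul_one, one_mul]
    have hyY : y ∈ T.PiY := by
      rw [← T.ker_zquot]
      exact hy
    rw [hyu]
    change m u = χ y (m u)
    rw [hχY ⟨y, hyY⟩, MulAut.one_apply]
  -- (1) the `Π^tp_X̲`-cyclotomic dictionary FAILS at the generator of `Gal(Y/X)`
  have hR1 : ¬ 𝔉.CyclotomicCharacterCompatX T (ContinuousMulEquiv.refl _).toMulEquiv m := by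
    intro h
    have key := h ((Multiplicative.ofAdd (1 : ℤ), (1 : Multiplicative (ZMod 2))) :
      Multiplicative ℤ × Multiplicative (ZMod 2)) (m.symm (Multiplicative.ofAdd 1))
      (m.symm (Multiplicative.ofAdd 1)) (by
        change ((m.symm _ : 𝔉.muTorsion 𝔉.BN 𝔉.N) : Aut 𝔉.BN) =
          (1 : Aut 𝔉.BN) * _ * (1 : Aut 𝔉.BN)⁻¹
        rw [inv_one, mul_one, one_mul])
    rw [MulEquiv.apply_symm_apply] at key
    change Multiplicative.ofAdd (1 : ZMod 6) =
      χ (Multiplicative.ofAdd (1 : ℤ), (1 : Multiplicative (ZMod 2))) (Multiplicative.ofAdd 1) at key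
    simp only [χ, MonoidHom.comp_apply, MonoidHom.coe_fst, zpowersHom_apply, toAdd_ofAdd, zpow_one,
      MulEquiv.inv_apply] at key
    exact absurd key (by decide)
  -- (2) the Prop. 5.2 (iii) dictionary FAILS for the constant `η := 1 ∈ ℤ/6`
  have hR2 : ¬ 𝔉.ThetaSectionCompat H T (ContinuousMulEquiv.refl _).toMulEquiv m hYdd
      (fun _ => Multiplicative.ofAdd (1 : ZMod 6)) := by
    intro h
    have key := h 1
    rw [𝔉.diffCocycle_one H, map_one] at key
    change (1 : Multiplicative (ZMod 6)) = (Multiplicative.ofAdd (1 : ZMod 6))⁻¹ at key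
    exact absurd key (by decide)
  -- (3) `KummerOutReached` FAILS for `DK := ∅`
  have hR3 : ¬ 𝔉.KummerOutReached H H.sectionsFactor 𝔉.outerActionLZ_of H.sgpCapSection
      H.sgpCupSection H.constantsEqNormalizer ∅ T (ContinuousMulEquiv.refl _) m hY hχ := by
    intro hK
    -- (a) `D = ⟨galOut ∪ constOut ∪ ∅⟩` is trivial: the ambient group `Aut_C(B_N) × Π^tp_X̲` is abelian
    have hamb : ∀ a b : Aut 𝔉.BN × 𝔉.PiX, a * b * a⁻¹ = b := fun a b => by
      rw [show a * b = b * a from Prod.ext (singleObj_aut_mul_comm a.1 b.1)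
        (mul_comm (G := Multiplicative ℤ × Multiplicative (ZMod 2)) a.2 b.2), mul_inv_cancel_right]
    have hconj : ∀ n : Subgroup.normalizer (𝔉.EPiN : Set (Aut 𝔉.BN × 𝔉.PiX)),
        𝔉.conjOut n = 1 := by
      intro n
      have hn : (⟨𝔉.EPiN.normalizerMonoidHom n, 𝔉.normalizerMonoidHom_mem_contMulAut n⟩ :
          contMulAut 𝔉.EPiN) = 1 := by
        apply Subtype.ext
        apply MulEquiv.ext
        intro x
        apply Subtype.ext
        exact hamb _ _
      change TopOut.mk _ _ = 1
      rw [hn, map_one]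
    have hDle : (𝔉.frdBiThetaEnv H.sectionsFactor 𝔉.outerActionLZ_of H.sgpCapSection
        H.sgpCupSection H.constantsEqNormalizer ∅).D ≤ ⊥ := by
      change Subgroup.closure _ ≤ ⊥
      rw [Subgroup.closure_le]
      rintro x ((⟨g, rfl⟩ | ⟨u, rfl⟩) | hx)
      · exact (Subgroup.mem_bot).mpr (hconj _)
      · exact (Subgroup.mem_bot).mpr (hconj _)
      · exact hx.elim
    unfold ThetaFrobenioid.KummerOutReached at hK
    -- (b) the Kummer shift by the cocycle `ℤ/2 → μ_6, 1 ↦ 3` inflated from `G_K = Π^tp_X`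
    let δ₂ : Multiplicative (ZMod 2) →* Multiplicative (ZMod 6) :=
      { toFun := fun b => Multiplicative.ofAdd ((3 : ZMod 6) * ((Multiplicative.toAdd b).val : ZMod 6))
        map_one' := by decide
        map_mul' := by intro a b; revert a b; decide }
    let δ : T.G → T.mu := fun p => δ₂ p.2
    have hδ : CycEnvelope.IsEnvCocycle T.augY T.chi (δ ∘ T.augY) := by
      intro g h
      change δ₂ ((g : Multiplicative ℤ × Multiplicative (ZMod 2)) * h).2 =
        δ₂ (g : Multiplicative ℤ × Multiplicative (ZMod 2)).2 *
          χ (g : Multiplicative ℤ × Multiplicative (ZMod 2)) (δ₂ (h : Multiplicative ℤ × _).2)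
      rw [hχY g, MulAut.one_apply, Prod.snd_mul, map_mul]
    haveI : DiscreteTopology T.env :=
      DiscreteTopology.of_continuous_injective
        (f := fun x : T.env => (x.left, x.right)) continuous_induced_dom
        (fun x y hxy => SemidirectProduct.ext (Prod.mk.inj hxy).1 (Prod.mk.inj hxy).2)
    have hc : CycEnvelope.shift hδ ∈ contMulAut T.env :=
      ⟨continuous_of_discreteTopology, continuous_of_discreteTopology⟩
    have hx₀ : TopOut.mk _ ⟨CycEnvelope.shift hδ, hc⟩ ∈ T.kummerOut := ⟨δ, hδ, hc, rfl⟩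
    have h1 : TopOut.mk _ ⟨CycEnvelope.shift hδ, hc⟩ = 1 := by
      obtain ⟨w, hw, hfw⟩ := Subgroup.mem_map.mp (hK hx₀)
      rw [← hfw, (Subgroup.mem_bot).mp (hDle hw)]
      exact map_one _
    -- (c) … is not inner: `Π^tp_Y[μ_6] = μ_6 × Π^tp_Y` is abelian at the toy
    have hinner : CycEnvelope.shift hδ ∈ innerAut T.env :=
      (Subgroup.mem_subgroupOf).mp ((QuotientGroup.eq_one_iff _).mp h1)
    obtain ⟨z, hz⟩ := hinner
    have henv : ∀ a b : T.env, a * b = b * a := by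
      intro a b
      have ha : (T.chi.comp T.augY) a.right = 1 := hχY a.right
      have hb : (T.chi.comp T.augY) b.right = 1 := hχY b.right
      apply SemidirectProduct.ext
      · rw [SemidirectProduct.mul_left, SemidirectProduct.mul_left, ha, hb, MulAut.one_apply,
          MulAut.one_apply]
        exact mul_comm (G := Multiplicative (ZMod 6)) _ _
      · rw [SemidirectProduct.mul_right, SemidirectProduct.mul_right]
        exact mul_comm (G := ↥PiY) _ _
    let p₀ : T.PiY := ⟨((1 : Multiplicative ℤ), Multiplicative.ofAdd (1 : ZMod 2)),
      (MonoidHom.mem_ker).mpr rfl⟩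
    let y₀ : T.env := ⟨1, p₀⟩
    have hfix : CycEnvelope.shift hδ y₀ = y₀ := by
      rw [← hz, MulAut.conj_apply, henv z y₀, mul_inv_cancel_right]
    have hleft := congrArg SemidirectProduct.left hfix
    change (1 : Multiplicative (ZMod 6)) * δ₂ (Multiplicative.ofAdd (1 : ZMod 2)) =
      (1 : Multiplicative (ZMod 6)) at hleft
    simp only [δ₂, MonoidHom.coe_mk, OneHom.coe_mk, one_mul] at hleft
    exact absurd hleft (by decide)
  exact ⟨𝔉, H, T, ContinuousMulEquiv.refl _, m, hY, hYdd, hχ, hR1, ⟨_, hR2⟩, hR3⟩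

/-! ### The three universal closures, REFUTED (FACT-LIST rows F-1306, F-0521, F-0520) -/

/-- **F-1306: the universal closure of `CyclotomicCharacterCompatX` is FALSE** — the `Π^tp_X̲`-cyclotomic
dictionary is a hypothesis on the identifications `(ι, m)` (at the toy the generator of `Gal(Y/X)` inverts
`μ_6` through `χ ∘ aug ∘ ι` while conjugation by `s^⊓-gp_N(ρ g)` is trivial).  Instance form at data
carrying the Galois dictionary of the constants: `BiratAutAction.cyclotomicCharacterCompatX_of_galoisDictionary`.
[cite: MochizukiEtTh2009, Lem 5.8 proof p.105 (PRIMS p.331)] -/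
theorem not_forall_cyclotomicCharacterCompatX :
    ¬ ∀ (C : Type) [Category.{0} C] (D : Type) [Category.{0} D] (𝔉 : ThetaFrobenioid.{0} C D)
        (T : ThetaEnvData.{0} 𝔉.N) (ι : 𝔉.PiX ≃* T.PiX) (m : 𝔉.muTorsion 𝔉.BN 𝔉.N ≃* T.mu),
        𝔉.CyclotomicCharacterCompatX T ι m := by
  intro h
  obtain ⟨𝔉, H, T, ι, m, hY, hYdd, hχ, h1, h2, h3⟩ := exists_toy
  exact h1 (h _ _ 𝔉 T ι.toMulEquiv m)

/-- **F-1306 is strictly stronger than F-1307 as typed**: there are data at which abc-iut-L2-t4's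
`Π^tp_Y̲`-dictionary `CyclotomicCharacterCompat` HOLDS and the `Π^tp_X̲`-dictionary FAILS (the converse
of `CyclotomicCharacterCompatX.toY` is false).  [cite: MochizukiEtTh2009, Lem 5.8 proof p.105 (PRIMS p.331)] -/
theorem exists_cyclotomicCharacterCompat_not_compatX :
    ∃ (C : Type) (_ : Category.{0} C) (D : Type) (_ : Category.{0} D) (𝔉 : ThetaFrobenioid.{0} C D)
      (T : ThetaEnvData.{0} 𝔉.N) (ι : 𝔉.PiX ≃* T.PiX) (m : 𝔉.muTorsion 𝔉.BN 𝔉.N ≃* T.mu),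
      𝔉.CyclotomicCharacterCompat T ι m ∧ ¬ 𝔉.CyclotomicCharacterCompatX T ι m := by
  obtain ⟨𝔉, H, T, ι, m, hY, hYdd, hχ, h1, h2, h3⟩ := exists_toy
  exact ⟨_, _, _, _, 𝔉, T, ι.toMulEquiv, m, hχ, h1⟩

/-- **F-0521: the universal closure of `ThetaSectionCompat` is FALSE** — the Prop. 5.2 (iii) dictionary is
a hypothesis on the cocycle `η` (it determines `η`; e.g. `η(1) = 1` is forced, and the constant `1 ∈ ℤ/6`
violates it at the toy).  [cite: MochizukiEtTh2009, Prop 5.2 (iii) p.98 (PRIMS p.324)] -/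
theorem not_forall_thetaSectionCompat :
    ¬ ∀ (C : Type) [Category.{0} C] (D : Type) [Category.{0} D] (𝔉 : ThetaFrobenioid.{0} C D)
        (H : 𝔉.Facts) (T : ThetaEnvData.{0} 𝔉.N) (ι : 𝔉.PiX ≃* T.PiX)
        (m : 𝔉.muTorsion 𝔉.BN 𝔉.N ≃* T.mu) (hYdd : 𝔉.IdentifiesPiYdd T ι) (η : T.PiYdd → T.mu),
        𝔉.ThetaSectionCompat H T ι m hYdd η := by
  intro h
  obtain ⟨𝔉, H, T, ι, m, hY, hYdd, hχ, h1, ⟨η, h2⟩, h3⟩ := exists_toy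
  exact h2 (h _ _ 𝔉 H T ι.toMulEquiv m hYdd η)

/-- **F-0520: the universal closure of `KummerOutReached` is FALSE** — with the residual `K^×`-datum
`DK := ∅` the subgroup `D ⊆ Out(E^Π_N)` generated by the `l·ℤ`- and `(O_K^×)^{1/N}`-actions need not reach
the Kummer part of `D_Y` (at the toy `D` is trivial while a Kummer shift is not inner).  Instance forms:
`kummerOutReached_preimage` (canonical `DK₀`), `BiratAutAction.kummerOutReached_birat`,
`BiratAutAction.kummerOutReached_of_continuous` (`DK := kummerOut`, from Kummer theory).
[cite: MochizukiEtTh2009, Lem 5.8 p.105 (PRIMS p.331); Lem 5.9 (iv) p.106 (PRIMS p.332)] -/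
theorem not_forall_kummerOutReached :
    ¬ ∀ (C : Type) [Category.{0} C] (D : Type) [Category.{0} D] (𝔉 : ThetaFrobenioid.{0} C D)
        (H : 𝔉.Facts) (h1 : 𝔉.SectionsFactor) (h3 : 𝔉.OuterActionLZ) (hsec : 𝔉.SgpCapSection)
        (hcs : 𝔉.SgpCupSection) (h8 : 𝔉.ConstantsEqNormalizer) (DK : Set (TopOut 𝔉.EPiN))
        (T : ThetaEnvData.{0} 𝔉.N) (ι : 𝔉.PiX ≃ₜ* T.PiX) (m : 𝔉.muTorsion 𝔉.BN 𝔉.N ≃* T.mu)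
        (hY : 𝔉.IdentifiesPiY T ι.toMulEquiv) (hχ : 𝔉.CyclotomicCharacterCompat T ι.toMulEquiv m),
        𝔉.KummerOutReached H h1 h3 hsec hcs h8 DK T ι m hY hχ := by
  intro h
  obtain ⟨𝔉, H, T, ι, m, hY, hYdd, hχ, h1, h2, h3⟩ := exists_toy
  exact h3 (h _ _ 𝔉 H _ _ _ _ _ ∅ T ι m hY hχ)

end ThetaFrobenioid

end Literature.AnabelianGeometry.EtaleTheta
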